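import Summits.ResolutionOfSingularities.ResolutionOfSingularities.Theorems.WildConesCampaignW46HypersurfacesCharTwoCubeCriterion
import Summits.ResolutionOfSingularities.ResolutionOfSingularities.Theorems.WildConesCampaignW46HypersurfacesCharTwoPairFreeCubic
import Summits.ResolutionOfSingularities.ResolutionOfSingularities.Theorems.WildConesCampaignW46ThreefoldsCharTwoFamily

/-!
# [OURS · L1 W4.6, rung (ii) at p = 2] THE CUBE WITNESS `z² = x³ + xy³`: an isolated corank-two surface double
# point of the multiple-tangent class `(e, h₂) = (2, 2)` whose satellite direction IS a null polar (the
# tangent cubic `s³` is a cube): its ONLY infinitely-near double point is the satellite, NO free point —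
# the second branch of the cube criterion / exact count is inhabited, over every field of characteristic 2

HONEST FRAMING. Everything here is OURS: theorems about route WildCones' own TYPED point-blow-up dynamics
(`Theorems/WildConesClassicalRegimesDefs.lean`) and the seat's invariants `polarMatrix` (p502936),
`milnorEmbDim` (p498937), `milnorHilbertTwo` (p511581), `degForm` (p522667). NOTHING here is a statement
of the manuscript [Hironaka2017]; no FACT-LIST premise; AI review is weaker than expert review. Cell
res-hironaka (LADDER-RESOLUTION rung L, D-0089), slot W4.6, seat res-L1-s46-pv-4 (gen 6); host route
`WildCones`, crux `ClassicalRegimes` (stmt-ResolutionOfSingularities-16884; proved).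

THE WITNESS. `a = x³ + xy³ = u^{(3,0)} + u^{(1,3)}` in `κ⟦x, y⟧` (`n = 2`, pair-free, so `e = 2` and every vector is a
kernel vector). In characteristic two `∂ₓa = x² + y³`, `∂_y a = xy²`, and `𝔪⁵ ≤ (∂a)`
(`x⁵ = x³·∂ₓa − x²y·∂_ya`, `x⁴y = x²y·∂ₓa − (∂_ya)²`, `x³y² = x²·∂_ya`, `x²y³ = xy·∂_ya`, `xy⁴ = y²·∂_ya`,
`y⁵ = y²·∂ₓa − x·∂_ya`): ISOLATED. Polars: `polar(λ, v) = λ₀v₀²`; so the null polars are the line `λ₀ = 0` and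
the satellite directions (`w₀² = 0`) are the SAME line `κ·(0,1)`: `N = S`, `h₂ = 2` (p542945's criterion: `(0,1)` is
a non-zero null polar, `polar((1,0),(1,0)) = 1 ≠ 0`). The tangent cubic is `a₃(w) = w₀³`, a CUBE. By the cube
criterion (p549448) there is NO free near double point: every double successor sits at `[(0,1)]` with corank two;
and that successor exists (chart `y` at the origin), isolated with smaller `μ`.

WHAT IS PROVED: `pderiv_cubeWitness`, `maximalIdeal_pow_five_le_jac_cubeWitness`, `cubeWitness_invariants`
(`MultP`, `¬OrdP`, `Isol`, `e = 2`, `h₂ = 2`), `cubeWitness_near_points` (the satellite successor at chart `1`,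
`τ = 0`: double, corank `2`, isolated, `μ` drops; EVERY double successor has near vector a multiple of `(0,1)` and
corank `2` — no free point), `surface_cube_witness` (existence over every field of characteristic `2`).

References: [CasasAlvero2000] §3 (context only); [GreuelPfister2026] (context); [Hironaka2017] Th. 16.6 p.84 —
role replaced only, under adjudication; nothing of it is used.
-/

noncomputable section

-- single-problem summit: the doubled namespace component `ResolutionOfSingularities` is forced
set_option linter.dupNamespace false

open scoped BigOperators Classical

open MvPowerSeries IsLocalRing

open Literature.AlgebraicGeometry.Resolution

namespace Summit.ResolutionOfSingularities.ResolutionOfSingularities.Theorems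

namespace CampaignW46.HypersurfacesCharTwo

open WildCones WildCones.MuDropCharTwoOrdP ThreefoldsCharTwo

variable {κ : Type} [Field κ]

/-! ## The series `x³ + xy³` -/

/-- [OURS · L1 W4.6] `x³ + xy³` in monomial form. [folklore] -/
theorem cubeWitness_eq :
    (X 0 ^ 3 + X 0 * X 1 ^ 3 : MvPowerSeries (Fin 2) κ) =
      monomial (Finsupp.single 0 3) (1 : κ) + monomial (Finsupp.single 0 1 + Finsupp.single 1 3) 1 := by
  rw [X_pow_eq, X_pow_eq, X_def, monomial_mul_monomial, one_mul]

/-- [OURS · L1 W4.6] Coefficients of `x³ + xy³`. [folklore] -/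
theorem coeff_cubeWitness (A : Fin 2 →₀ ℕ) :
    coeff A (X 0 ^ 3 + X 0 * X 1 ^ 3 : MvPowerSeries (Fin 2) κ) =
      (if A = Finsupp.single 0 3 then 1 else 0) +
        (if A = Finsupp.single 0 1 + Finsupp.single 1 3 then 1 else 0) := by
  rw [cubeWitness_eq, map_add, coeff_monomial, coeff_monomial]

/-- [OURS · L1 W4.6] The two exponents differ. [folklore] -/
theorem single_three_ne : (Finsupp.single 0 3 : Fin 2 →₀ ℕ) ≠ Finsupp.single 0 1 + Finsupp.single 1 3 := by
  intro h; have := DFunLike.congr_fun h 0; simp at this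

/-- [OURS · L1 W4.6] A state with cleaned series `x³ + xy³` exists (no monomial with all exponents even).
[folklore] -/
theorem exists_ser_eq_cubeWitness : ∃ c : (Fin 2 → ℕ) → κ, ser 2 2 κ c = X 0 ^ 3 + X 0 * X 1 ^ 3 := by
  refine exists_ser_eq _ fun A hA => ?_
  rw [coeff_cubeWitness]
  have h1 : A ≠ Finsupp.single 0 3 := by rintro rfl; have := hA 0; simp at this
  have h2 : A ≠ Finsupp.single 0 1 + Finsupp.single 1 3 := by rintro rfl; have := hA 0; simp at this
  rw [if_neg h1, if_neg h2, add_zero]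

/-- [OURS · L1 W4.6] A state with cleaned series `x³ + xy³` is a double point and pair-free. [folklore] -/
theorem multP_not_ordP_of_ser_eq_cubeWitness {c : (Fin 2 → ℕ) → κ}
    (hc : ser 2 2 κ c = X 0 ^ 3 + X 0 * X 1 ^ 3) : MultP 2 2 κ c ∧ ¬ OrdP 2 2 κ c := by
  constructor
  · rw [multP_iff_ser, hc]
    constructor
    · intro h
      have h1 := congrArg (coeff (Finsupp.single (0 : Fin 2) 3)) h
      rw [coeff_cubeWitness, if_pos rfl, if_neg single_three_ne, map_zero, add_zero] at h1
      exact one_ne_zero h1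
    · refine nat_le_order fun d hd => ?_
      rw [coeff_cubeWitness]
      have h1 : d ≠ Finsupp.single 0 3 := by
        rintro rfl; rw [Finsupp.degree_single] at hd; omega
      have h2 : d ≠ Finsupp.single 0 1 + Finsupp.single 1 3 := by
        rintro rfl; rw [map_add, Finsupp.degree_single, Finsupp.degree_single] at hd; omega
      rw [if_neg h1, if_neg h2, add_zero]
  · rw [ordP_two_iff_exists_pair, hc]
    rintro ⟨j, l, -, h⟩
    rw [coeff_cubeWitness] at h
    have hdeg : (Finsupp.single j 1 + Finsupp.single l 1 : Fin 2 →₀ ℕ).degree = 2 := by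
      rw [map_add, Finsupp.degree_single, Finsupp.degree_single]
    have h1 : (Finsupp.single j 1 + Finsupp.single l 1 : Fin 2 →₀ ℕ) ≠ Finsupp.single 0 3 := by
      intro h'; rw [h', Finsupp.degree_single] at hdeg; omega
    have h2 : (Finsupp.single j 1 + Finsupp.single l 1 : Fin 2 →₀ ℕ) ≠ Finsupp.single 0 1 + Finsupp.single 1 3 := by
      intro h'; rw [h', map_add, Finsupp.degree_single, Finsupp.degree_single] at hdeg; omega
    rw [if_neg h1, if_neg h2, add_zero] at h
    exact h rfl

/-! ## Partials and isolatedness -/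

/-- [OURS · L1 W4.6] In characteristic two: `∂₀ (x³ + xy³) = x² + y³`, `∂₁ (x³ + xy³) = xy²`. [folklore] -/
theorem pderiv_cubeWitness [CharP κ 2] (s : Fin 2) :
    MvPowerSeries.pderiv s (X 0 ^ 3 + X 0 * X 1 ^ 3 : MvPowerSeries (Fin 2) κ) =
      if s = 0 then X 0 ^ 2 + X 1 ^ 3 else X 0 * X 1 ^ 2 := by
  have h2 : (2 : MvPowerSeries (Fin 2) κ) = 0 := by
    rw [← map_ofNat (C : κ →+* _) 2, CharTwo.two_eq_zero (R := κ), map_zero]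
  have h3 : (3 : MvPowerSeries (Fin 2) κ) = 1 := by
    rw [show (3 : MvPowerSeries (Fin 2) κ) = 2 + 1 by norm_num, h2, zero_add]
  rw [map_add, Derivation.leibniz, Derivation.leibniz_pow, Derivation.leibniz_pow, MvPowerSeries.pderiv_X,
    MvPowerSeries.pderiv_X]
  fin_cases s <;> simp [h3]

/-- [OURS · L1 W4.6] A monomial of `κ⟦x,y⟧` is `x^a y^b`. [folklore] -/
theorem monomial_fin_two_eq (e : Fin 2 →₀ ℕ) :
    (monomial e (1 : κ) : MvPowerSeries (Fin 2) κ) = X 0 ^ (e 0) * X 1 ^ (e 1) := by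
  have he : e = Finsupp.single 0 (e 0) + Finsupp.single 1 (e 1) := by
    ext t
    fin_cases t <;> simp
  rw [X_pow_eq, X_pow_eq, monomial_mul_monomial, one_mul, ← he]

/-- [OURS · L1 W4.6] `𝔪⁵ ≤ (x² + y³, xy²)`: every monomial of degree five lies in the gradient ideal of `x³ + xy³`
(explicit combinations, characteristic two). [folklore] -/
theorem maximalIdeal_pow_five_le_jac_cubeWitness [CharP κ 2] :
    maximalIdeal (MvPowerSeries (Fin 2) κ) ^ 5 ≤
      Ideal.span (Set.range fun s : Fin 2 => MvPowerSeries.pderiv s (X 0 ^ 3 + X 0 * X 1 ^ 3 : MvPowerSeries (Fin 2) κ)) := by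
  -- the gradient ideal is `(P, Q)` with `P = x² + y³`, `Q = xy²`
  set P : MvPowerSeries (Fin 2) κ := X 0 ^ 2 + X 1 ^ 3 with hP
  set Q : MvPowerSeries (Fin 2) κ := X 0 * X 1 ^ 2 with hQ
  have hJ : Ideal.span ({P, Q} : Set (MvPowerSeries (Fin 2) κ)) ≤
      Ideal.span (Set.range fun s : Fin 2 => MvPowerSeries.pderiv s (X 0 ^ 3 + X 0 * X 1 ^ 3 : MvPowerSeries (Fin 2) κ)) := by
    rw [Ideal.span_le]
    rintro g hg
    rcases hg with rfl | hg
    · exact Ideal.subset_span ⟨0, by beta_reduce; rw [pderiv_cubeWitness, if_pos rfl]⟩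
    · rw [Set.mem_singleton_iff] at hg
      subst hg
      exact Ideal.subset_span ⟨1, by beta_reduce; rw [pderiv_cubeWitness, if_neg (by decide)]⟩
  refine le_trans ?_ hJ
  rw [Literature.RingTheory.MvPowerSeries.Jets.maximalIdeal_pow_eq_span_monomial, Ideal.span_le]
  rintro _ ⟨e, he, rfl⟩
  change e.degree = 5 at he
  change (monomial e (1 : κ) : MvPowerSeries (Fin 2) κ) ∈ _
  have hsum : e 0 + e 1 = 5 := by rw [← he, degree_eq_sum_univ, Fin.sum_univ_two]
  rw [monomial_fin_two_eq, SetLike.mem_coe, Ideal.mem_span_pair]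
  -- `x^a y^b = α P + β Q` case by case on `a = e 0`
  have h5 : e 0 ≤ 5 := by omega
  interval_cases h0 : e 0
  · -- `y⁵ = y² P − x Q`
    have h1 : e 1 = 5 := by omega
    exact ⟨X 1 ^ 2, -X 0, by rw [h1, hP, hQ]; ring⟩
  · -- `x y⁴ = y² Q`
    have h1 : e 1 = 4 := by omega
    exact ⟨0, X 1 ^ 2, by rw [h1, hQ]; ring⟩
  · -- `x² y³ = x y Q`
    have h1 : e 1 = 3 := by omega
    exact ⟨0, X 0 * X 1, by rw [h1, hQ]; ring⟩
  · -- `x³ y² = x² Q`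
    have h1 : e 1 = 2 := by omega
    exact ⟨0, X 0 ^ 2, by rw [h1, hQ]; ring⟩
  · -- `x⁴ y = x² y P − Q²`
    have h1 : e 1 = 1 := by omega
    exact ⟨X 0 ^ 2 * X 1, -Q, by rw [h1, hP, hQ]; ring⟩
  · -- `x⁵ = x³ P − x² y Q`
    have h1 : e 1 = 0 := by omega
    exact ⟨X 0 ^ 3, -(X 0 ^ 2 * X 1), by rw [h1, hP, hQ]; ring⟩

/-- [OURS · L1 W4.6] A state with cleaned series `x³ + xy³` is ISOLATED (`(∂a) ⊇ 𝔪⁵`). [folklore] -/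
theorem isol_of_ser_eq_cubeWitness [CharP κ 2] {c : (Fin 2 → ℕ) → κ} (hc : ser 2 2 κ c = X 0 ^ 3 + X 0 * X 1 ^ 3) :
    Isol 2 2 κ c := by
  rw [isol_iff_finite_pderiv, hc]
  haveI := Literature.RingTheory.MvPowerSeries.Jets.finite_quotient_maximalIdeal_pow (σ := Fin 2) (K := κ) 5
  exact Module.Finite.of_surjective (Ideal.Quotient.factorₐ κ maximalIdeal_pow_five_le_jac_cubeWitness).toLinearMap
    (Ideal.Quotient.factor_surjective maximalIdeal_pow_five_le_jac_cubeWitness)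

/-! ## Polars and the tangent cubic -/

/-- [OURS · L1 W4.6] THE POLARS of `x³ + xy³`: `Σₛ λₛ (∂ₛa)₂(v) = λ₀ v₀²` (`(x² + y³)₂ = x²`, `(xy²)₂ = 0`).
[folklore] -/
theorem polar_cubeWitness [CharP κ 2] (lam v : Fin 2 → κ) :
    ∑ s, lam s * degForm 2 (MvPowerSeries.pderiv s (X 0 ^ 3 + X 0 * X 1 ^ 3 : MvPowerSeries (Fin 2) κ)) v =
      lam 0 * v 0 ^ 2 := by
  have hq : degForm 2 (X 0 ^ 2 + X 1 ^ 3 : MvPowerSeries (Fin 2) κ) v = v 0 ^ 2 := by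
    rw [X_pow_eq, X_pow_eq, degForm_add, degForm_monomial (by rw [Finsupp.degree_single]),
      degForm_monomial_of_ne (by rw [Finsupp.degree_single]; norm_num), Fin.prod_univ_two, add_zero]
    simp
  have hq' : degForm 2 (X 0 * X 1 ^ 2 : MvPowerSeries (Fin 2) κ) v = 0 := by
    rw [X_pow_eq, X_def, monomial_mul_monomial,
      degForm_monomial_of_ne (by rw [map_add, Finsupp.degree_single, Finsupp.degree_single]; norm_num)]
  rw [Fin.sum_univ_two, pderiv_cubeWitness, pderiv_cubeWitness, if_pos rfl, if_neg (by decide : (1 : Fin 2) ≠ 0),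
    hq, hq', mul_zero, add_zero]

/-- [OURS · L1 W4.6] THE TANGENT CUBIC of `x³ + xy³` is the cube `a₃(w) = w₀³`. [folklore] -/
theorem degForm_three_cubeWitness (w : Fin 2 → κ) :
    degForm 3 (X 0 ^ 3 + X 0 * X 1 ^ 3 : MvPowerSeries (Fin 2) κ) w = w 0 ^ 3 := by
  rw [cubeWitness_eq, degForm_add, degForm_monomial (by rw [Finsupp.degree_single]),
    degForm_monomial_of_ne (by rw [map_add, Finsupp.degree_single, Finsupp.degree_single]; norm_num),
    Fin.prod_univ_two, add_zero]
  simp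

/-! ## The invariants and the near points -/

/-- [OURS · L1 W4.6 rung (ii) at `p = 2`, `n = 2`; NOT a statement of the manuscript] **`x³ + xy³`: an isolated
pair-free (corank-two) double point with `h₂ = 2`** — from the null-polar criterion p542945: `polar(λ, v) = λ₀v₀²`,
`(0,1)` is a non-zero null polar and `polar((1,0),(1,0)) = 1 ≠ 0`. [folklore] -/
theorem cubeWitness_invariants [CharP κ 2] {c : (Fin 2 → ℕ) → κ} (hc : ser 2 2 κ c = X 0 ^ 3 + X 0 * X 1 ^ 3) :
    MultP 2 2 κ c ∧ ¬ OrdP 2 2 κ c ∧ Isol 2 2 κ c ∧ milnorEmbDim 2 2 κ c = 2 ∧ milnorHilbertTwo 2 2 κ c = 2 := by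
  obtain ⟨hM, hO⟩ := multP_not_ordP_of_ser_eq_cubeWitness hc
  have hI := isol_of_ser_eq_cubeWitness hc
  have he : milnorEmbDim 2 2 κ c = 2 := (not_ordP_iff_milnorEmbDim_eq hM).mp hO
  have hker : ∀ v : Fin 2 → κ, Matrix.vecMul v (polarMatrix (ser 2 2 κ c)) = 0 := fun v => by
    rw [polarMatrix_eq_zero_of_not_ordP hO, Matrix.vecMul_zero]
  have hh : milnorHilbertTwo 2 2 κ c = 2 := by
    refine (hypersurface_milnorHilbertTwo_eq_two_iff_null_polar_line c hM he).mpr ⟨⟨![0, 1], ?_, hker _, ?_⟩,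
      ⟨![1, 0], ![1, 0], hker _, hker _, ?_⟩⟩
    · intro h; have := congrFun h 1; simp at this
    · intro v _; rw [hc, polar_cubeWitness]; simp
    · rw [hc, polar_cubeWitness]; simp
  exact ⟨hM, hO, hI, he, hh⟩

/-- [OURS · L1 W4.6 rung (ii) at `p = 2`, `n = 2`; NOT a statement of the manuscript] **`x³ + xy³` HAS EXACTLY ONE
INFINITELY-NEAR DOUBLE POINT, THE SATELLITE, AND NO FREE POINT**: the chart `y` at the origin (near vector `(0,1)`,
the triple root of the tangent cubic `s³`) gives a double successor of corank `2`, isolated with smaller `μ`; and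
EVERY double successor, in any chart and translation, has near vector a multiple of `(0,1)` and corank `2` (the
satellite direction is a null polar: cube criterion p549448) — in particular no double successor has corank `0`.
[folklore] -/
theorem cubeWitness_near_points [CharP κ 2] {c : (Fin 2 → ℕ) → κ} (hc : ser 2 2 κ c = X 0 ^ 3 + X 0 * X 1 ^ 3) :
    (MultP 2 2 κ (step 2 2 κ 1 0 c) ∧ milnorEmbDim 2 2 κ (step 2 2 κ 1 0 c) = 2 ∧ Isol 2 2 κ (step 2 2 κ 1 0 c) ∧
        mu 2 2 κ (step 2 2 κ 1 0 c) < mu 2 2 κ c) ∧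
      (∀ (i : Fin 2) (τ : Fin 2 → κ), MultP 2 2 κ (step 2 2 κ i τ c) →
        (∃ r : κ, Function.update τ i 1 = r • Function.update (0 : Fin 2 → κ) 1 1) ∧
          milnorEmbDim 2 2 κ (step 2 2 κ i τ c) = 2) ∧
      ∀ (i : Fin 2) (τ : Fin 2 → κ), MultP 2 2 κ (step 2 2 κ i τ c) → milnorEmbDim 2 2 κ (step 2 2 κ i τ c) ≠ 0 := by
  obtain ⟨hM, hO, hI, he, hh⟩ := cubeWitness_invariants hc
  have hker : ∀ v : Fin 2 → κ, Matrix.vecMul v (polarMatrix (ser 2 2 κ c)) = 0 := fun v => by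
    rw [polarMatrix_eq_zero_of_not_ordP hO, Matrix.vecMul_zero]
  have hpol : ∀ lam v : Fin 2 → κ, ∑ s, lam s * degForm 2 (MvPowerSeries.pderiv s (ser 2 2 κ c)) v = lam 0 * v 0 ^ 2 :=
    fun lam v => by rw [hc, polar_cubeWitness]
  have hw₀ : Function.update (0 : Fin 2 → κ) 1 1 = ![0, 1] := by
    funext s; fin_cases s <;> simp
  -- `(0,1)` is a satellite AND a null polar
  have hsat : ∀ lam : Fin 2 → κ, Matrix.vecMul lam (polarMatrix (ser 2 2 κ c)) = 0 →
      ∑ s, lam s * degForm 2 (MvPowerSeries.pderiv s (ser 2 2 κ c)) (Function.update (0 : Fin 2 → κ) 1 1) = 0 := by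
    intro lam _; rw [hpol, hw₀]; simp
  have hnull : ∀ v : Fin 2 → κ, Matrix.vecMul v (polarMatrix (ser 2 2 κ c)) = 0 →
      ∑ s, (Function.update (0 : Fin 2 → κ) 1 1) s * degForm 2 (MvPowerSeries.pderiv s (ser 2 2 κ c)) v = 0 := by
    intro v _; rw [hpol, hw₀]; simp
  -- the satellite successor
  have hMs : MultP 2 2 κ (step 2 2 κ 1 0 c) := by
    refine (hypersurface_multP_step_iff c 1 0 hM hI).mpr ⟨hker _, ?_⟩
    rw [hc, degForm_three_cubeWitness, hw₀]; simp
  have hes : milnorEmbDim 2 2 κ (step 2 2 κ 1 0 c) = 2 :=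
    (hypersurface_milnorEmbDim_step_eq_two_iff c 1 0 hM he hMs).mpr hsat
  have honly : ∀ (i : Fin 2) (τ : Fin 2 → κ), MultP 2 2 κ (step 2 2 κ i τ c) →
      (∃ r : κ, Function.update τ i 1 = r • Function.update (0 : Fin 2 → κ) 1 1) ∧
        milnorEmbDim 2 2 κ (step 2 2 κ i τ c) = 2 :=
    fun i τ hM' => hypersurface_only_satellite_of_satellite_null c hM he (by omega) (update_one_ne_zero 0 1) (hker _)
      hsat hnull i τ hM'
  exact ⟨⟨hMs, hes, hypersurface_isol_step_of_milnorHilbertTwo_le_two c 1 0 hM hI he (by omega) hMs⟩, honly,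
    fun i τ hM' h0 => by have h := (honly i τ hM').2; omega⟩

/-- [OURS · L1 W4.6 rung (ii) at `p = 2`; NOT a statement of the manuscript] **THE CUBE BRANCH IS INHABITED**, over every
field of characteristic `2`, already for surfaces: there is an isolated corank-two double state with `h₂ = 2` whose
only infinitely-near double point is its satellite (corank-two successor), with NO free near point (`x³ + xy³`).
Non-vacuity of the second alternative of `CampaignW46HypersurfacesHilbertTwoExactCount` / the `⇒` direction of
`CampaignW46HypersurfacesCubeCriterion` at `p = 2`, `n = 2`. [folklore] -/
theorem surface_cube_witness (κ : Type) [Field κ] [CharP κ 2] :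
    ∃ c : (Fin 2 → ℕ) → κ, MultP 2 2 κ c ∧ Isol 2 2 κ c ∧ milnorEmbDim 2 2 κ c = 2 ∧ milnorHilbertTwo 2 2 κ c = 2 ∧
      (MultP 2 2 κ (step 2 2 κ 1 0 c) ∧ milnorEmbDim 2 2 κ (step 2 2 κ 1 0 c) = 2) ∧
      ∀ (i : Fin 2) (τ : Fin 2 → κ), MultP 2 2 κ (step 2 2 κ i τ c) → milnorEmbDim 2 2 κ (step 2 2 κ i τ c) ≠ 0 := by
  obtain ⟨c, hc⟩ := exists_ser_eq_cubeWitness (κ := κ)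
  obtain ⟨hM, -, hI, he, hh⟩ := cubeWitness_invariants hc
  obtain ⟨⟨hMs, hes, -, -⟩, -, hnofree⟩ := cubeWitness_near_points hc
  exact ⟨c, hM, hI, he, hh, ⟨hMs, hes⟩, hnofree⟩

end CampaignW46.HypersurfacesCharTwo

end Summit.ResolutionOfSingularities.ResolutionOfSingularities.Theorems

end
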